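import Literature.Analysis.FluidPDE.NewtonPotentialTestSource
import Literature.Analysis.FluidPDE.NewtonPotentialFarField
import Literature.Analysis.FluidPDE.PressurePoisson
import Literature.Analysis.FluidPDE.WholeSpaceIBP
import HarnessLib

/-!
# The classical Leray (Helmholtz) projection of a smooth compactly supported field on `ℝ³`

Analysis/FluidPDE support file (two definitions with bodies, everything proved, no named facts).
For a smooth compactly supported vector field `G : ℝ³ → ℝ³` the **Newtonian potential of its
divergence**

  `π[G] := (div G) ⋆ Γ`,  `π[G](x) = ∫ Γ(x − t) div G(t) dt`,  `Γ(z) = −(4π|z|)⁻¹`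
  (`divPotential`; the tree's `newtonKernel` and Mathlib's convolution, source on the left),

is smooth with `Δ π[G] = div G` (Poisson's equation for the Newtonian potential,
Gilbarg–Trudinger Lemma 4.2, here the tree's `laplacian_convolution_newtonKernel`), so that

  `P[G] := G − ∇π[G]`   (`classicalLerayProj`)

is a smooth **divergence-free** field: the classical Helmholtz–Leray decomposition
`G = P[G] + ∇π[G]` of a test field into a solenoidal part and a gradient (Galdi, *An Introduction
to the Mathematical Theory of the Navier–Stokes Equations*, §III.1; Majda–Bertozzi §1.8,
Prop. 1.16 "Hodge's Decomposition in `ℝᴺ`", (1.91): `v = w + ∇q`, `div w = 0`, `Δq = div v`,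
`𝒫v = w`; Lemarié-Rieusset 2002, Ch. 11). Since `∫ div G = 0`
(divergence theorem; this is the step "by the Green's formula the first term is zero" of the
proof of Prop. 1.16, p. 33), the monopole term of the far-field expansion of `π[G]` vanishes and
the tree's zeroth-order expansion of the Newtonian potential
(`abs_integral_newtonKernel_mul_sub_le`, `NewtonPotentialFarField.lean`) gives the **dipole decay**
`|π[G](x)| ≤ K ‖x‖⁻²` for `‖x‖ ≥ 4`, whence **`π[G] ∈ L²(ℝ³)`**
(`lintegral_enorm_sq_divPotential_lt_top`). This is the classical pressure of a compactly
supported forcing: for the Navier–Stokes nonlinearity `B = u·∇u` (or its linearisation at a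
compactly supported background) `P[B] = B + ∇q` with the pressure `q = −π[B] = −Δ⁻¹ div B ∈ L²`.

## Main statements (`G ∈ C_c^∞(ℝ³; ℝ³)`)

* `contDiff_divPotential`, `laplacian_divPotential` (`Δπ[G] = div G`);
* `contDiff_classicalLerayProj`, `isDivFree_classicalLerayProj` (`div P[G] = 0`),
  `classicalLerayProj_add_gradient` (`P[G] + ∇π[G] = G`);
* `exists_abs_divPotential_le` (`|π[G](x)| ≤ K‖x‖⁻²`, `‖x‖ ≥ 4`),
  `lintegral_enorm_sq_divPotential_lt_top` (`π[G] ∈ L²`);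
* `divPotential_gradient` (`π[∇φ] = φ`), `classicalLerayProj_gradient` (`P[∇φ] = 0`),
  `classicalLerayProj_eq_self_of_isDivFree` (`P[G] = G` when `div G = 0`): `P` is a projection
  onto divergence-free fields along gradients (Majda–Bertozzi §1.8: `𝒫v = v` iff `div v = 0`,
  `𝒫∇p = 0`).

The identification of `P[G]` with the tree's `L²` Leray projector `lerayProjector`
(`LerayProjector.lean`, orthogonal projection onto `L²_σ`) is not made here (it needs the
membership of the algebraically decaying smooth solenoidal field `P[G]` in `L²_σ`); the file is
the pointwise, classical side used by classical-solution interfaces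
(`NSLerayHopfABCEigenmode.lean`).

## Tree / Mathlib search

Tree: `newtonKernel`, `convolution_newtonKernel_apply'`, `contDiff_convolution_newtonKernel`,
`laplacian_convolution_newtonKernel` (`NewtonPotentialTestSource`);
`abs_integral_newtonKernel_mul_sub_le` (`NewtonPotentialFarField`); `contDiff_divergence`,
`continuous_divergence`, `divergence_eq_zero_of_notMem_tsupport`, `integral_divergence_eq_zero`
(`WholeSpaceIBP` and its imports); `divergence_gradient`, `divergence_sub_apply`
(`PressurePoisson`). The tree's `LocalHelmholtzSlice.potential` is the TRUNCATED potential
`N[div w]` (compactly supported, `Δ = div w` only on a ball); the whole-space projection with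
its decay is not in the tree (`lean search 'divPotential|classicalLeray|helmholtzProj'`: nothing).
Mathlib: `integrable_one_add_norm`, `Integrable.lintegral_lt_top`,
`IsCompact.exists_bound_of_continuousOn`, `Continuous.bounded_above_of_compact_support`.

## References

* G. P. Galdi, *An Introduction to the Mathematical Theory of the Navier–Stokes Equations*,
  2nd ed. (Springer 2011), §III.1 (Helmholtz–Weyl decomposition). [Galdi2011]
* A. J. Majda, A. L. Bertozzi, *Vorticity and Incompressible Flow* (CUP 2002), §1.8,
  Prop. 1.15 (Leray's formulation, the projection `𝒫`) and Prop. 1.16 with its proof, (1.91),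
  pp. 32–34 (Hodge's decomposition in `ℝᴺ`, `Δq = div v`, `∇q = O(|x|⁻ᴺ)` for `v ∈ C_0^∞`
  because `∫ div v = 0`). [MajdaBertozziCUP2002]
* D. Gilbarg, N. S. Trudinger, *Elliptic Partial Differential Equations of Second Order* (2001),
  Lemmas 4.1–4.2 (Newtonian potential). [GilbargTrudinger2001]
-/

noncomputable section

open MeasureTheory Set Filter Topology Function Metric ContinuousLinearMap InnerProductSpace
open scoped ENNReal NNReal Convolution ContDiff Laplacian

namespace Literature.Analysis.FluidPDE

/-! ### Definitions -/

/-- **The Newtonian potential of the divergence** of a vector field `G : ℝ³ → ℝ³`: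
`π[G] := (div G) ⋆ Γ`, `π[G](x) = ∫ Γ(x − t) div G(t) dt` with `Γ(z) = −(4π|z|)⁻¹`
(`newtonKernel`), i.e. `π[G] = Δ⁻¹ div G` for a test field (`laplacian_divPotential`)
(Majda–Bertozzi 2002, §1.8, proof of Prop. 1.16: "apply the divergence operator to (1.91) to get
`Δq = div v` … solving this Poisson equation for `q`" by the fundamental solution;
Gilbarg–Trudinger (2.17)–(2.18)). [cite: MajdaBertozziCUP2002, §1.8 Prop. 1.16 (1.91), pp. 32–33] -/
def divPotential (G : EuclideanSpace ℝ (Fin 3) → EuclideanSpace ℝ (Fin 3)) :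
    EuclideanSpace ℝ (Fin 3) → ℝ :=
  (VectorCalculus.divergence G) ⋆[lsmul ℝ ℝ, volume] newtonKernel

/-- **The classical Leray (Helmholtz) projection** of a vector field `G : ℝ³ → ℝ³`:
`P[G] := G − ∇π[G] = G − ∇Δ⁻¹ div G`, the solenoidal part of the Helmholtz decomposition
`G = P[G] + ∇π[G]` of a test field (`isDivFree_classicalLerayProj`,
`classicalLerayProj_add_gradient`) (Majda–Bertozzi 2002, §1.8, Prop. 1.15–1.16: the projection
`𝒫` on divergence-free fields, `𝒫v = w = v − ∇q`; Galdi 2011, §III.1).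
[cite: MajdaBertozziCUP2002, §1.8 Prop. 1.16 (1.91), pp. 32–33] -/
def classicalLerayProj (G : EuclideanSpace ℝ (Fin 3) → EuclideanSpace ℝ (Fin 3)) :
    EuclideanSpace ℝ (Fin 3) → EuclideanSpace ℝ (Fin 3) :=
  fun ξ => G ξ - gradient (divPotential G) ξ

variable {G : EuclideanSpace ℝ (Fin 3) → EuclideanSpace ℝ (Fin 3)}

/-- Unfolding `divPotential` as an integral: `π[G](x) = ∫ Γ(x − t) div G(t) dt`. [folklore] -/
theorem divPotential_apply (G : EuclideanSpace ℝ (Fin 3) → EuclideanSpace ℝ (Fin 3))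
    (x : EuclideanSpace ℝ (Fin 3)) :
    divPotential G x = ∫ t, newtonKernel (x - t) * VectorCalculus.divergence G t :=
  convolution_newtonKernel_apply' _ _

/-- Unfolding `classicalLerayProj`: `P[G](ξ) = G(ξ) − ∇π[G](ξ)`. [folklore] -/
theorem classicalLerayProj_apply (G : EuclideanSpace ℝ (Fin 3) → EuclideanSpace ℝ (Fin 3))
    (ξ : EuclideanSpace ℝ (Fin 3)) :
    classicalLerayProj G ξ = G ξ - gradient (divPotential G) ξ := rfl

/-- `P[G] + ∇π[G] = G` (the Helmholtz decomposition (1.91), by definition of `P`).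
[cite: MajdaBertozziCUP2002, §1.8 Prop. 1.16 (1.91)] -/
theorem classicalLerayProj_add_gradient (G : EuclideanSpace ℝ (Fin 3) → EuclideanSpace ℝ (Fin 3))
    (ξ : EuclideanSpace ℝ (Fin 3)) :
    classicalLerayProj G ξ + gradient (divPotential G) ξ = G ξ := by
  rw [classicalLerayProj_apply, sub_add_cancel]

/-! ### Regularity of the divergence and of the potential -/

/-- The divergence of a compactly supported field is compactly supported (a private copy of the
tree's `hasCompactSupport_divergence`, `StokesWholeSpacePressure.lean`, to keep the imports of
this file light). [folklore] -/
private theorem hasCompactSupport_divergence' (hGc : HasCompactSupport G) :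
    HasCompactSupport (VectorCalculus.divergence G) :=
  hGc.mono' fun x hx => by
    by_contra h
    exact hx (divergence_eq_zero_of_notMem_tsupport h)

/-- The divergence of a smooth field is smooth. [folklore] -/
theorem contDiff_divergence_of_contDiff_top (hG : ContDiff ℝ ∞ G) :
    ContDiff ℝ ∞ (VectorCalculus.divergence G) :=
  contDiff_infty.2 fun n => contDiff_divergence (n := n) (contDiff_infty.1 hG _)

/-- The gradient of a smooth scalar function is smooth. [folklore] -/
theorem contDiff_gradient_of_contDiff_top {p : EuclideanSpace ℝ (Fin 3) → ℝ} (hp : ContDiff ℝ ∞ p) :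
    ContDiff ℝ ∞ (gradient p) := by
  have e : gradient p = fun x => (InnerProductSpace.toDual ℝ (EuclideanSpace ℝ (Fin 3))).symm
      (fderiv ℝ p x) := rfl
  rw [e]
  exact (InnerProductSpace.toDual ℝ (EuclideanSpace ℝ (Fin 3))).symm.contDiff.comp
    (contDiff_infty_iff_fderiv.1 hp).2

/-- **`π[G] ∈ C^∞`** for `G ∈ C_c^∞` (the source `div G ∈ C_c^∞` carries all derivatives of the
convolution). [cite: GilbargTrudinger2001, Lemma 4.1] -/
theorem contDiff_divPotential (hG : ContDiff ℝ ∞ G) (hGc : HasCompactSupport G) :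
    ContDiff ℝ ∞ (divPotential G) :=
  contDiff_convolution_newtonKernel (contDiff_divergence_of_contDiff_top hG)
    (hasCompactSupport_divergence' hGc)

/-- **Poisson's equation `Δπ[G] = div G`** for `G ∈ C_c^∞`. [cite: GilbargTrudinger2001, Lemma 4.2] -/
theorem laplacian_divPotential (hG : ContDiff ℝ ∞ G) (hGc : HasCompactSupport G)
    (x : EuclideanSpace ℝ (Fin 3)) :
    (Δ (divPotential G)) x = VectorCalculus.divergence G x :=
  laplacian_convolution_newtonKernel ((contDiff_divergence_of_contDiff_top hG).of_le (by norm_cast))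
    (hasCompactSupport_divergence' hGc) x

/-- **`P[G] ∈ C^∞`** for `G ∈ C_c^∞`. [cite: MajdaBertozziCUP2002, §1.8 Prop. 1.16 (i)] -/
theorem contDiff_classicalLerayProj (hG : ContDiff ℝ ∞ G) (hGc : HasCompactSupport G) :
    ContDiff ℝ ∞ (classicalLerayProj G) :=
  hG.sub (contDiff_gradient_of_contDiff_top (contDiff_divPotential hG hGc))

/-- **`div P[G] = 0`**: the classical Leray projection of a test field is divergence free
(`div(G − ∇π[G]) = div G − Δπ[G] = 0`). [cite: MajdaBertozziCUP2002, §1.8 Prop. 1.16 (1.91)] -/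
theorem isDivFree_classicalLerayProj (hG : ContDiff ℝ ∞ G) (hGc : HasCompactSupport G) :
    VectorCalculus.IsDivFree (classicalLerayProj G) := fun x => by
  have hp : ContDiff ℝ ∞ (divPotential G) := contDiff_divPotential hG hGc
  have hp2 : ContDiff ℝ 2 (divPotential G) := hp.of_le (by norm_cast)
  have hdG : DifferentiableAt ℝ G x := (hG.differentiable (by simp)) x
  have hdg : DifferentiableAt ℝ (gradient (divPotential G)) x :=
    ((contDiff_gradient_of_contDiff_top hp).differentiable (by simp)) x
  change VectorCalculus.divergence (fun y => G y - gradient (divPotential G) y) x = 0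
  rw [divergence_sub_apply hdG hdg, divergence_gradient hp2, laplacian_divPotential hG hGc, sub_self]

/-! ### Decay and square integrability of the potential -/

/-- **Dipole decay of `π[G]`**: for `G ∈ C_c^∞` there is `K` with `|π[G](x)| ≤ K ‖x‖⁻²` for
`‖x‖ ≥ 4` — the zeroth-order far-field expansion of the Newtonian potential
(`abs_integral_newtonKernel_mul_sub_le`) of the source `div G`, whose total mass `∫ div G`
vanishes by the divergence theorem (Majda–Bertozzi 2002, proof of Prop. 1.16, p. 33: "by the
Green's formula the first term is zero", there for `∇q`). [cite: MajdaBertozziCUP2002, §1.8 proof of Prop. 1.16, p. 33] -/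
theorem exists_abs_divPotential_le (hG : ContDiff ℝ ∞ G) (hGc : HasCompactSupport G) :
    ∃ K : ℝ, ∀ x : EuclideanSpace ℝ (Fin 3), 4 ≤ ‖x‖ → |divPotential G x| ≤ K * ‖x‖⁻¹ ^ 2 := by
  set F : EuclideanSpace ℝ (Fin 3) → ℝ := VectorCalculus.divergence G with hF
  have hFc : Continuous F := (contDiff_divergence_of_contDiff_top hG).continuous
  have hFs : HasCompactSupport F := hasCompactSupport_divergence' hGc
  have hFi : Integrable F := hFc.integrable_of_hasCompactSupport hFs
  have hMs : HasCompactSupport fun y : EuclideanSpace ℝ (Fin 3) => ‖y‖ * F y := hFs.mul_left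
  have hM : Integrable fun y : EuclideanSpace ℝ (Fin 3) => ‖y‖ * F y :=
    (continuous_norm.mul hFc).integrable_of_hasCompactSupport hMs
  -- `‖y‖⁴ |F y|` is bounded (continuous with compact support)
  have h4c : Continuous fun y : EuclideanSpace ℝ (Fin 3) => ‖y‖ ^ 4 * |F y| :=
    (continuous_norm.pow 4).mul hFc.abs
  have h4s : HasCompactSupport fun y : EuclideanSpace ℝ (Fin 3) => ‖y‖ ^ 4 * |F y| :=
    (hFs.abs).mul_left
  obtain ⟨C₄, hC₄⟩ := h4c.bounded_above_of_compact_support h4s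
  have hC₄' : ∀ y : EuclideanSpace ℝ (Fin 3), ‖y‖ ^ 4 * |F y| ≤ C₄ := fun y =>
    (le_abs_self _).trans ((Real.norm_eq_abs _).symm.le.trans (hC₄ y))
  -- the monopole moment vanishes
  have h0 : ∫ y, F y = 0 := integral_divergence_eq_zero (hG.of_le (by norm_cast)) hGc
  refine ⟨(7 / (2 * Real.pi) * ∫ y, ‖y‖ * |F y|) +
    3 * (volume : Measure (EuclideanSpace ℝ (Fin 3))).real (ball 0 1) / (8 * Real.pi) * C₄,
    fun x hx => ?_⟩
  have h := abs_integral_newtonKernel_mul_sub_le hFi hM hC₄' hx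
  rw [h0, zero_mul, sub_zero] at h
  rw [divPotential_apply]
  exact h

/-- **`π[G] ∈ L²(ℝ³)`** for `G ∈ C_c^∞`: `∫ |π[G]|² < ∞` (bounded on `‖x‖ ≤ 4`, `≤ K‖x‖⁻²`
outside, and `(1 + ‖x‖)⁻⁴` is integrable on `ℝ³`). [folklore] -/
theorem lintegral_enorm_sq_divPotential_lt_top (hG : ContDiff ℝ ∞ G) (hGc : HasCompactSupport G) :
    ∫⁻ x, ‖divPotential G x‖ₑ ^ 2 < ⊤ := by
  obtain ⟨K, hK⟩ := exists_abs_divPotential_le hG hGc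
  have hpc : Continuous (divPotential G) := (contDiff_divPotential hG hGc).continuous
  obtain ⟨M, hM⟩ := (isCompact_closedBall (0 : EuclideanSpace ℝ (Fin 3)) 4).exists_bound_of_continuousOn
    hpc.continuousOn
  -- a global majorant `|π[G](x)|² ≤ C (1 + ‖x‖)⁻⁴`
  set C : ℝ := M ^ 2 * 625 + 4 * K ^ 2 with hC
  have hmaj : ∀ x : EuclideanSpace ℝ (Fin 3),
      divPotential G x ^ 2 ≤ C * (1 + ‖x‖) ^ (-4 : ℝ) := by
    intro x
    have hr0 : 0 ≤ ‖x‖ := norm_nonneg x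
    have hpow : (1 + ‖x‖) ^ (-4 : ℝ) = ((1 + ‖x‖) ^ 4)⁻¹ := by
      rw [show (-4 : ℝ) = -((4 : ℕ) : ℝ) by norm_num, Real.rpow_neg (by positivity),
        Real.rpow_natCast]
    rw [hpow, ← div_eq_mul_inv, le_div_iff₀ (by positivity)]
    by_cases hx : ‖x‖ ≤ 4
    · -- on the ball: `|π| ≤ M`, `(1 + ‖x‖)⁴ ≤ 5⁴`
      have h1 : ‖divPotential G x‖ ≤ M := hM x (mem_closedBall_zero_iff.2 hx)
      rw [Real.norm_eq_abs] at h1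
      have hM0 : 0 ≤ M := (abs_nonneg _).trans h1
      have h2 : divPotential G x ^ 2 ≤ M ^ 2 := by
        rw [← sq_abs]
        exact pow_le_pow_left₀ (abs_nonneg _) h1 2
      have h3 : (1 + ‖x‖) ^ 4 ≤ (5 : ℝ) ^ 4 := pow_le_pow_left₀ (by positivity) (by linarith) 4
      have h4 : 0 ≤ (1 + ‖x‖) ^ 4 := by positivity
      calc divPotential G x ^ 2 * (1 + ‖x‖) ^ 4 ≤ M ^ 2 * (5 : ℝ) ^ 4 :=
            mul_le_mul h2 h3 h4 (sq_nonneg _)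
        _ ≤ C := by rw [hC]; nlinarith [sq_nonneg K]
    · -- outside: `|π| ≤ K ‖x‖⁻²`, `(1 + ‖x‖)⁴ ≤ (625/256) ‖x‖⁴`
      rw [not_le] at hx
      have hxp : 0 < ‖x‖ := lt_trans (by norm_num) hx
      have h1 : |divPotential G x| ≤ K * ‖x‖⁻¹ ^ 2 := hK x hx.le
      have h2 : divPotential G x ^ 2 ≤ (K * ‖x‖⁻¹ ^ 2) ^ 2 := by
        rw [← sq_abs]
        exact pow_le_pow_left₀ (abs_nonneg _) h1 2
      have h3 : 4 * (1 + ‖x‖) ≤ 5 * ‖x‖ := by linarith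
      have h4 : (4 * (1 + ‖x‖)) ^ 4 ≤ (5 * ‖x‖) ^ 4 := pow_le_pow_left₀ (by positivity) h3 4
      have h4' : (4 : ℝ) ^ 4 * (1 + ‖x‖) ^ 4 ≤ (5 : ℝ) ^ 4 * ‖x‖ ^ 4 := by
        rw [← mul_pow, ← mul_pow]; exact h4
      norm_num at h4'
      have h5 : (1 + ‖x‖) ^ 4 ≤ 4 * ‖x‖ ^ 4 := by nlinarith [h4', pow_nonneg hr0 4]
      have hinv : ‖x‖⁻¹ ^ 2 * ‖x‖ ^ 2 = 1 := by
        rw [← mul_pow, inv_mul_cancel₀ hxp.ne', one_pow]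
      calc divPotential G x ^ 2 * (1 + ‖x‖) ^ 4
          ≤ (K * ‖x‖⁻¹ ^ 2) ^ 2 * (4 * ‖x‖ ^ 4) :=
            mul_le_mul h2 h5 (by positivity) (sq_nonneg _)
        _ = 4 * K ^ 2 * (‖x‖⁻¹ ^ 2 * ‖x‖ ^ 2) ^ 2 := by ring
        _ = 4 * K ^ 2 := by rw [hinv, one_pow, mul_one]
        _ ≤ C := by rw [hC]; nlinarith [sq_nonneg M]
  have hint : Integrable (fun x : EuclideanSpace ℝ (Fin 3) => C * (1 + ‖x‖) ^ (-4 : ℝ)) :=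
    (integrable_one_add_norm (by rw [finrank_euclideanSpace]; norm_num)).const_mul C
  calc ∫⁻ x, ‖divPotential G x‖ₑ ^ 2 = ∫⁻ x, ENNReal.ofReal (divPotential G x ^ 2) :=
        lintegral_congr fun x => by
          rw [Real.enorm_eq_ofReal_abs, ← ENNReal.ofReal_pow (abs_nonneg _), sq_abs]
    _ ≤ ∫⁻ x, ENNReal.ofReal (C * (1 + ‖x‖) ^ (-4 : ℝ)) :=
        lintegral_mono fun x => ENNReal.ofReal_le_ofReal (hmaj x)
    _ < ⊤ := hint.lintegral_lt_top

/-! ### `P` is a projection onto divergence-free fields along gradients -/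

/-- **`π[∇φ] = φ`** for `φ ∈ C_c^∞`: the potential of the divergence of a gradient is the
function itself (`div ∇φ = Δφ` and Green's representation `∫ Γ(x − t) Δφ(t) dt = φ(x)`).
[cite: GilbargTrudinger2001, (2.17)] -/
theorem divPotential_gradient {φ : EuclideanSpace ℝ (Fin 3) → ℝ} (hφ : ContDiff ℝ ∞ φ)
    (hφc : HasCompactSupport φ) (x : EuclideanSpace ℝ (Fin 3)) :
    divPotential (gradient φ) x = φ x := by
  have hφ2 : ContDiff ℝ 2 φ := hφ.of_le (by norm_cast)
  have hdiv : VectorCalculus.divergence (gradient φ) = Δ φ := funext (divergence_gradient hφ2)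
  rw [divPotential_apply, hdiv]
  exact integral_newtonKernel_mul_laplacian hφ2 hφc x

/-- **`P[∇φ] = 0`** for `φ ∈ C_c^∞`: the classical Leray projection annihilates gradients
(Majda–Bertozzi 2002, §1.8: `𝒫∇p = 0`). [cite: MajdaBertozziCUP2002, §1.8 p. 32 (𝒫∇p = 0)] -/
theorem classicalLerayProj_gradient {φ : EuclideanSpace ℝ (Fin 3) → ℝ} (hφ : ContDiff ℝ ∞ φ)
    (hφc : HasCompactSupport φ) : classicalLerayProj (gradient φ) = 0 := by
  have h : divPotential (gradient φ) = φ := funext (divPotential_gradient hφ hφc)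
  funext ξ
  rw [classicalLerayProj_apply, h, sub_self]
  rfl

/-- **`π[G] = 0` for a divergence-free `G`** (the source `div G` vanishes). [folklore] -/
theorem divPotential_eq_zero_of_isDivFree (h : VectorCalculus.IsDivFree G) :
    divPotential G = 0 := by
  have h0 : VectorCalculus.divergence G = 0 := funext h
  rw [divPotential, h0, zero_convolution]

/-- **`P[G] = G` for a divergence-free `G`** (Majda–Bertozzi 2002, §1.8: `𝒫v = v` iff
`div v = 0`). [cite: MajdaBertozziCUP2002, §1.8 p. 32 (𝒫v = v iff div v = 0)] -/
theorem classicalLerayProj_eq_self_of_isDivFree (h : VectorCalculus.IsDivFree G) :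
    classicalLerayProj G = G := by
  funext ξ
  rw [classicalLerayProj_apply, divPotential_eq_zero_of_isDivFree h, sub_eq_self, gradient,
    fderiv_zero]
  simp

end Literature.Analysis.FluidPDE

end
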